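import Summits.Ventures.PercRepro2.CaseOnePairPocketMain

/-!
# A worked example of the second pocket reduction: `a₃` and `o` together in a pocket at the root `a₁`
(blind cell PercRepro2, p1 g27)

Seven vertices `o = 0, a₁ = 1, a₂ = 2, b = 3, a₃ = 4`, the hub `5` and a further pocket vertex `6`;
outside the edges `a₁–a₂` and `a₂–b`; the pocket `W = {0, 4, 5, 6}` at the root `1` carries the `K₄` on
`{1, 0, 4, 5}` and the two edges `0–6`, `4–6`. `closedAt_of_pair_at_root` gives the four case-1 forms at
`4` for EVERY weight vector (`closedAt_pair_k4`) — `a₃` and the mark `o` share a pocket that is neither a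
tree nor series–parallel, and no earlier class theorem of the lane applies. Own code; standard axioms. -/

namespace Summit.Ventures.PercRepro2

namespace CaseOne

namespace PairPocketExample

/-- The ends of the ten edges: `0: {1,2}`, `1: {2,3}` outside; `2: {1,0}`, `3: {1,4}`, `4: {1,5}`
(the stem), `5: {0,4}`, `6: {0,5}` (the `o`-branch), `7: {4,5}` (the `a₃`-branch), `8: {0,6}`,
`9: {4,6}` in the pocket. -/
def ends : Fin 10 → Sym2 (Fin 7) :=
  ![s(1, 2), s(2, 3), s(1, 0), s(1, 4), s(1, 5), s(0, 4), s(0, 5), s(4, 5), s(0, 6), s(4, 6)]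

/-- The interior of the pocket. -/
def W : Set (Fin 7) := ↑({0, 4, 5, 6} : Finset (Fin 7))

/-- The edges of the pocket. -/
def P : Finset (Fin 10) := {2, 3, 4, 5, 6, 7, 8, 9}

/-- `(W, 1, P)` is a pocket. -/
theorem isPocket : IsPocket ends W 1 P where
  x_not_mem := by simp [W]
  mem_iff := by
    intro e
    simp only [W, Finset.mem_coe]
    revert e
    decide
  ends_mem := by
    intro e he y hy
    simp only [W, Finset.mem_coe]
    revert e y
    decide

/-- The pair pocket: hub `5`, designated vertices `a₃ = 4` and `o = 0`, the stem `4`, the branches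
`7` (to `a₃`) and `6` (to `o`). -/
theorem isPairPocket : IsPairPocket ends W 1 P 4 7 6 5 4 0 where
  pocket := isPocket
  mem₁ := by decide
  mem₂ := by decide
  mem₃ := by decide
  ne₁₂ := by decide
  ne₁₃ := by decide
  ne₂₃ := by decide
  hub := by simp [W]
  mem_z₁ := by simp [W]
  mem_z₂ := by simp [W]
  hub_ne₁ := by decide
  hub_ne₂ := by decide
  ne_z := by decide

/-- **The four case-1 forms at `a₃ = 4` hold for every weight vector** (over `ℚ`; `a₃` and `o` share
the pocket at the root `a₁ = 1`). -/
theorem closedAt_pair_k4 : ClosedAt ℚ 0 1 2 3 (Fin 10) ends 4 :=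
  closedAt_of_pair_at_root isPairPocket (Or.inl rfl) (by simp [W]) (by simp [W]) (by simp [W])

/-- `(J1₁)` at `4` for every weight vector. -/
theorem jOneOne_pair_k4 (p : Fin 10 → ℚ) (hp : IsProbVec p) : JOneOne p ends 0 1 2 4 3 :=
  jOneOne_of_pair_at_root isPairPocket (Or.inl rfl) (by simp [W]) (by simp [W]) (by simp [W]) p hp

end PairPocketExample

end CaseOne

end Summit.Ventures.PercRepro2
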